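import Summits.NavierStokesRegularity.NavierStokesRegularity.Theorems.SoloSalvageWu2026AbelTail
import Mathlib.MeasureTheory.Integral.MeanInequalities
import Mathlib.Analysis.SpecialFunctions.Pow.Continuity
import HarnessLib

/-!
# C177 `Wu2026` — SALVAGE, TRUE column: the local convergence of the tangent current, first limit
# of (3.85) (D-0090 NS-CLAIMS, LADDER row rung 3; salvage seat `ns-claims-salvage-p3`)

Third helper toward the binder `Literature.Claims.NS.Wu2026.Step_385`. The print (p.26 l.68–84,
«By (3.28), (3.45), and q₀ > 3, we have Q_jV_j → QV in L¹_loc(ℝ³ ∖ {0}) … First letting j → ∞ …»)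
passes to the limit in the rescaled current on bounded shells from the strong local convergences of
the Euler blow-down tangent: `V_j → V` in `L^{q₀}_loc(ℝ³ ∖ {0})` (3.28) = `Tangent.convV` and
`P_j → P` in `L^{q₀/2}_loc` (3.45) = `Tangent.convP`, `3 < q₀ < 9/2`. This file proves, for every
compact `K ⊆ ℝ³ ∖ {0}`, `∫_K |Q_jV_j − QV| → 0` (`tendsto_lintegral_bernV_sub`), by the pointwise
splitting `|Q₁V₁ − Q₂V₂| ≤ |P₁−P₂||V₁−V₂| + |P₁−P₂||V₂| + |P₂||V₁−V₂| + 3|V₂|²|V₁−V₂| + 3|V₂||V₁−V₂|²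
+ |V₁−V₂|³` and Hölder on `K` with the pairs `(q₀/2, q₀/(q₀−2))`, `(3/2, 3)`, `(3, 3/2)` — the
exponents `q₀/(q₀−2)` and `3` are `≤ q₀` exactly because `q₀ ≥ 3`, so they are reached from `L^{q₀}(K)`
on the finite measure `K` (`setLIntegral_rpow_le_of_lt`).

Theorems only, standard axioms, no `sorry`.

WHAT THIS IS NOT: not a claim about NS regularity or blow-up; not a claim about any author beyond the
typed locator.
-/

set_option linter.dupNamespace false

noncomputable section

open MeasureTheory Set Filter Topology Module Metric
open scoped ENNReal NNReal Topology RealInnerProductSpace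

namespace Summit.NavierStokesRegularity.NavierStokesRegularity.Theorems.Wu2026Salvage

open Literature.Analysis.FluidPDE Literature.Analysis.FunctionSpaces Literature.Claims.NS.Wu2026

/-! ## Generic `ℝ≥0∞` tools on a set of finite measure -/

/-- `ENNReal.ofReal (‖z‖^r) = ‖z‖ₑ^r` for `r ≥ 0`. [folklore] -/
theorem ofReal_norm_rpow {F' : Type*} [NormedAddCommGroup F'] (z : F') {r : ℝ} (hr : 0 ≤ r) :
    ENNReal.ofReal (‖z‖ ^ r) = ‖z‖ₑ ^ r := by
  rw [← ofReal_norm, ENNReal.ofReal_rpow_of_nonneg (norm_nonneg _) hr]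

/-- Local `L^r`-integrability in `ℝ≥0∞` form: `∫_K |f|^r < ∞` gives `∫⁻_K ‖f‖ₑ^r < ∞`. [folklore] -/
theorem lintegral_enorm_rpow_lt_top_of_integrableOn {F' : Type*} [NormedAddCommGroup F']
    {f : E3 → F'} {K : Set E3} {r : ℝ} (hr : 0 ≤ r)
    (h : IntegrableOn (fun y => ‖f y‖ ^ r) K volume) : ∫⁻ y in K, ‖f y‖ₑ ^ r < ∞ := by
  have h2 : ∫⁻ y in K, ‖‖f y‖ ^ r‖ₑ < ∞ := h.2
  refine lt_of_le_of_lt (le_of_eq (lintegral_congr fun y => ?_)) h2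
  rw [Real.enorm_eq_ofReal (Real.rpow_nonneg (norm_nonneg _) _), ofReal_norm_rpow _ hr]

/-- A continuous function has `∫⁻_K ‖f‖ₑ^r < ∞` on every compact `K`, `r ≥ 0`. [folklore] -/
theorem lintegral_enorm_rpow_lt_top_of_continuous {F' : Type*} [NormedAddCommGroup F']
    {f : E3 → F'} (hf : Continuous f) {K : Set E3} (hK : IsCompact K) {r : ℝ} (hr : 0 ≤ r) :
    ∫⁻ y in K, ‖f y‖ₑ ^ r < ∞ := by
  obtain ⟨B, hB⟩ := hK.exists_bound_of_continuousOn hf.continuousOn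
  have hB' : ∀ y ∈ K, ‖f y‖ ≤ max B 0 := fun y hy => (hB y hy).trans (le_max_left _ _)
  have hB0 : 0 ≤ max B 0 := le_max_right _ _
  calc ∫⁻ y in K, ‖f y‖ₑ ^ r ≤ ∫⁻ _ in K, ENNReal.ofReal ((max B 0) ^ r) := by
        refine setLIntegral_mono' hK.measurableSet fun y hy => ?_
        rw [← ofReal_norm_rpow _ hr]
        exact ENNReal.ofReal_le_ofReal (Real.rpow_le_rpow (norm_nonneg _) (hB' y hy) hr)
    _ = ENNReal.ofReal ((max B 0) ^ r) * volume K := by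
        rw [lintegral_const, Measure.restrict_apply_univ]
    _ < ∞ := ENNReal.mul_lt_top ENNReal.ofReal_lt_top hK.measure_lt_top

/-- **Exponent reduction on a set** (Hölder against `1`): for `0 < s < r`,
`∫⁻_K f^s ≤ (∫⁻_K f^r)^{s/r} |K|^{1 − s/r}`. [folklore] -/
theorem setLIntegral_rpow_le_of_lt {f : E3 → ℝ≥0∞} {K : Set E3}
    (hf : AEMeasurable f (volume.restrict K)) {s r : ℝ} (hs : 0 < s) (hsr : s < r) :
    ∫⁻ x in K, f x ^ s ≤ (∫⁻ x in K, f x ^ r) ^ (s / r) * volume K ^ (1 - s / r) := by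
  have hr : 0 < r := hs.trans hsr
  have ha : 0 < s / r := by positivity
  have hb : 0 < 1 - s / r := by rw [sub_pos, div_lt_one hr]; exact hsr
  have hpq : (s / r)⁻¹.HolderConjugate (1 - s / r)⁻¹ := Real.HolderConjugate.inv_inv ha hb (by ring)
  have hfs : AEMeasurable (fun x => f x ^ s) (volume.restrict K) := hf.pow_const s
  have h := ENNReal.lintegral_mul_le_Lp_mul_Lq (volume.restrict K) hpq hfs aemeasurable_const
    (g := fun _ => 1)
  simp only [Pi.mul_apply, mul_one, ENNReal.one_rpow, lintegral_const, Measure.restrict_apply_univ,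
    one_mul, one_div, inv_inv] at h
  refine h.trans (le_of_eq ?_)
  congr 1
  have hrs : ∀ x, (f x ^ s) ^ (s / r)⁻¹ = f x ^ r := fun x => by
    rw [← ENNReal.rpow_mul]
    congr 1
    field_simp
  simp_rw [hrs]

/-- **Hölder on a set**, in the form used below: for `0 < s, t` with `s + t = 1`,
`∫⁻_K f g ≤ (∫⁻_K f^{1/s})^{s} (∫⁻_K g^{1/t})^{t}`. [folklore] -/
theorem setLIntegral_mul_le_holder {f g : E3 → ℝ≥0∞} {K : Set E3}
    (hf : AEMeasurable f (volume.restrict K)) (hg : AEMeasurable g (volume.restrict K))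
    {s t : ℝ} (hs : 0 < s) (ht : 0 < t) (hst : s + t = 1) :
    ∫⁻ x in K, f x * g x ≤ (∫⁻ x in K, f x ^ s⁻¹) ^ s * (∫⁻ x in K, g x ^ t⁻¹) ^ t := by
  have hpq : s⁻¹.HolderConjugate t⁻¹ := Real.HolderConjugate.inv_inv hs ht hst
  have h := ENNReal.lintegral_mul_le_Lp_mul_Lq (volume.restrict K) hpq hf hg
  simp only [Pi.mul_apply, one_div, inv_inv] at h
  exact h

/-- `X_j → 0` in `ℝ≥0∞` gives `X_j^θ · B → 0` for `θ > 0`, `B ≠ ∞`. [folklore] -/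
theorem tendsto_rpow_mul_const_zero {X : ℕ → ℝ≥0∞} (hX : Tendsto X atTop (𝓝 0)) {θ : ℝ}
    (hθ : 0 < θ) {B : ℝ≥0∞} (hB : B ≠ ∞) :
    Tendsto (fun j => X j ^ θ * B) atTop (𝓝 0) := by
  have h1 : Tendsto (fun j => X j ^ θ) atTop (𝓝 0) := by
    have hc : Tendsto (fun a : ℝ≥0∞ => a ^ θ) (𝓝 0) (𝓝 ((0 : ℝ≥0∞) ^ θ)) :=
      (ENNReal.continuous_rpow_const (y := θ)).tendsto (0 : ℝ≥0∞)
    rw [ENNReal.zero_rpow_of_pos hθ] at hc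
    exact hc.comp hX
  have := ENNReal.Tendsto.mul_const h1 (Or.inr hB)
  rwa [zero_mul] at this

/-- Squeeze to zero in `ℝ≥0∞`. [folklore] -/
theorem tendsto_zero_of_le {X Y : ℕ → ℝ≥0∞} (hY : Tendsto Y atTop (𝓝 0)) (h : ∀ j, X j ≤ Y j) :
    Tendsto X atTop (𝓝 0) :=
  tendsto_of_tendsto_of_tendsto_of_le_of_le tendsto_const_nhds hY (fun j => bot_le (a := X j)) h

/-- From real to `ℝ≥0∞` integrals: if `g_j ≥ 0`, `∫⁻_K g_j < ∞` and `∫_K g_j → 0` then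
`∫⁻_K g_j → 0`. [folklore] -/
theorem tendsto_lintegral_of_tendsto_integral {g : ℕ → E3 → ℝ} {K : Set E3}
    (hg0 : ∀ j y, 0 ≤ g j y) (hgm : ∀ j, AEStronglyMeasurable (g j) (volume.restrict K))
    (hfin : ∀ j, ∫⁻ y in K, ENNReal.ofReal (g j y) ≠ ∞)
    (h : Tendsto (fun j => ∫ y in K, g j y) atTop (𝓝 0)) :
    Tendsto (fun j => ∫⁻ y in K, ENNReal.ofReal (g j y)) atTop (𝓝 0) := by
  have heq : ∀ j, ∫⁻ y in K, ENNReal.ofReal (g j y) = ENNReal.ofReal (∫ y in K, g j y) := fun j => by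
    rw [integral_eq_lintegral_of_nonneg_ae (Eventually.of_forall (hg0 j)) (hgm j),
      ENNReal.ofReal_toReal (hfin j)]
  simp_rw [heq]
  rw [← ENNReal.ofReal_zero]
  exact ENNReal.tendsto_ofReal h

/-! ## The pointwise splitting of `Q₁V₁ − Q₂V₂` -/

/-- `|Q₁V₁ − Q₂V₂| ≤ |P₁−P₂||V₁−V₂| + |P₁−P₂||V₂| + |P₂||V₁−V₂| + 3|V₂|²|V₁−V₂| + 3|V₂||V₁−V₂|² +
|V₁−V₂|³`, `Q_i = P_i + |V_i|²/2` (the algebra behind «Q_jV_j → QV in L¹_loc … q₀ > 3», p.26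
l.68–70). [cite: Wu2026, (3.85) proof p.26 l.68–70] -/
theorem norm_bernV_sub_le (V₁ V₂ : E3 → E3) (P₁ P₂ : E3 → ℝ) (y : E3) :
    ‖bern V₁ P₁ y • V₁ y - bern V₂ P₂ y • V₂ y‖ ≤
      |P₁ y - P₂ y| * ‖V₁ y - V₂ y‖ + |P₁ y - P₂ y| * ‖V₂ y‖ + |P₂ y| * ‖V₁ y - V₂ y‖ +
      (3 * ‖V₂ y‖ ^ 2 * ‖V₁ y - V₂ y‖ + 3 * ‖V₂ y‖ * ‖V₁ y - V₂ y‖ ^ 2 + ‖V₁ y - V₂ y‖ ^ 3) := by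
  set a : E3 := V₁ y
  set b : E3 := V₂ y
  set e : ℝ := P₁ y - P₂ y
  have hsplit : bern V₁ P₁ y • a - bern V₂ P₂ y • b =
      (e • (a - b) + e • b + P₂ y • (a - b)) +
        (1 / 2 : ℝ) • (‖a‖ ^ 2 • (a - b) + (‖a‖ ^ 2 - ‖b‖ ^ 2) • b) := by
    simp only [bern, smul_sub, sub_smul, add_smul, smul_add, smul_smul]
    module
  rw [hsplit]
  have hd : ‖a‖ ≤ ‖b‖ + ‖a - b‖ := by
    calc ‖a‖ = ‖b + (a - b)‖ := by rw [add_sub_cancel]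
      _ ≤ ‖b‖ + ‖a - b‖ := norm_add_le _ _
  have h1 : ‖e • (a - b) + e • b + P₂ y • (a - b)‖ ≤ |e| * ‖a - b‖ + |e| * ‖b‖ + |P₂ y| * ‖a - b‖ := by
    calc ‖e • (a - b) + e • b + P₂ y • (a - b)‖
        ≤ ‖e • (a - b)‖ + ‖e • b‖ + ‖P₂ y • (a - b)‖ := norm_add₃_le
      _ = |e| * ‖a - b‖ + |e| * ‖b‖ + |P₂ y| * ‖a - b‖ := by
          rw [norm_smul, norm_smul, norm_smul, Real.norm_eq_abs, Real.norm_eq_abs]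
  have h2 : ‖(1 / 2 : ℝ) • (‖a‖ ^ 2 • (a - b) + (‖a‖ ^ 2 - ‖b‖ ^ 2) • b)‖ ≤
      3 * ‖b‖ ^ 2 * ‖a - b‖ + 3 * ‖b‖ * ‖a - b‖ ^ 2 + ‖a - b‖ ^ 3 := by
    have hsq : |‖a‖ ^ 2 - ‖b‖ ^ 2| ≤ ‖a - b‖ * (‖a‖ + ‖b‖) := by
      rw [sq_sub_sq, abs_mul, mul_comm]
      gcongr
      · exact abs_norm_sub_norm_le a b
      · exact le_of_eq (abs_of_nonneg (by positivity))
    calc ‖(1 / 2 : ℝ) • (‖a‖ ^ 2 • (a - b) + (‖a‖ ^ 2 - ‖b‖ ^ 2) • b)‖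
        = 1 / 2 * ‖‖a‖ ^ 2 • (a - b) + (‖a‖ ^ 2 - ‖b‖ ^ 2) • b‖ := by
          rw [norm_smul, Real.norm_of_nonneg (by norm_num)]
      _ ≤ 1 / 2 * (‖a‖ ^ 2 * ‖a - b‖ + ‖a - b‖ * (‖a‖ + ‖b‖) * ‖b‖) := by
          gcongr
          calc ‖‖a‖ ^ 2 • (a - b) + (‖a‖ ^ 2 - ‖b‖ ^ 2) • b‖
              ≤ ‖‖a‖ ^ 2 • (a - b)‖ + ‖(‖a‖ ^ 2 - ‖b‖ ^ 2) • b‖ := norm_add_le _ _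
            _ = ‖a‖ ^ 2 * ‖a - b‖ + |‖a‖ ^ 2 - ‖b‖ ^ 2| * ‖b‖ := by
                rw [norm_smul, norm_smul, Real.norm_of_nonneg (by positivity), Real.norm_eq_abs]
            _ ≤ ‖a‖ ^ 2 * ‖a - b‖ + ‖a - b‖ * (‖a‖ + ‖b‖) * ‖b‖ := by gcongr
      _ ≤ 3 * ‖b‖ ^ 2 * ‖a - b‖ + 3 * ‖b‖ * ‖a - b‖ ^ 2 + ‖a - b‖ ^ 3 := by
          have hb0 : 0 ≤ ‖b‖ := norm_nonneg _
          have hd0 : 0 ≤ ‖a - b‖ := norm_nonneg _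
          have ha0 : 0 ≤ ‖a‖ := norm_nonneg _
          nlinarith [mul_nonneg hb0 hd0, mul_nonneg (mul_nonneg hb0 hd0) hd0,
            mul_nonneg (mul_nonneg hb0 hb0) hd0, mul_nonneg (mul_nonneg hd0 hd0) hd0,
            mul_le_mul_of_nonneg_right hd hd0]
  exact (norm_add_le _ _).trans (add_le_add h1 h2)

/-- The same splitting in `ℝ≥0∞`. [cite: Wu2026, (3.85) proof p.26 l.68–70] -/
theorem enorm_bernV_sub_le (V₁ V₂ : E3 → E3) (P₁ P₂ : E3 → ℝ) (y : E3) :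
    ‖bern V₁ P₁ y • V₁ y - bern V₂ P₂ y • V₂ y‖ₑ ≤
      ‖P₁ y - P₂ y‖ₑ * ‖V₁ y - V₂ y‖ₑ + ‖P₁ y - P₂ y‖ₑ * ‖V₂ y‖ₑ + ‖P₂ y‖ₑ * ‖V₁ y - V₂ y‖ₑ +
      (3 * ‖V₂ y‖ₑ ^ 2 * ‖V₁ y - V₂ y‖ₑ + 3 * ‖V₂ y‖ₑ * ‖V₁ y - V₂ y‖ₑ ^ 2 +
        ‖V₁ y - V₂ y‖ₑ ^ 3) := by
  have h := norm_bernV_sub_le V₁ V₂ P₁ P₂ y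
  rw [← ofReal_norm (bern V₁ P₁ y • V₁ y - bern V₂ P₂ y • V₂ y), Real.enorm_eq_ofReal_abs,
    Real.enorm_eq_ofReal_abs, ← ofReal_norm (V₁ y - V₂ y), ← ofReal_norm (V₂ y),
    ← ENNReal.ofReal_ofNat 3]
  iterate 3 rw [← ENNReal.ofReal_pow (norm_nonneg _)]
  iterate 7 rw [← ENNReal.ofReal_mul (by positivity)]
  iterate 5 rw [← ENNReal.ofReal_add (by positivity) (by positivity)]
  exact ENNReal.ofReal_le_ofReal h

/-! ## The abstract six-term limit on a set of finite measure -/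

/-- **The Hölder bookkeeping of (3.85)** on a set `K` of finite measure, for `3 < q₀`: if
`∫_K d_j^{q₀} → 0`, `∫_K e_j^{q₀/2} → 0`, `∫_K V^{q₀} < ∞`, `∫_K P^{q₀/2} < ∞`, then
`∫_K (e_j d_j + e_j V + P d_j + 3V²d_j + 3Vd_j² + d_j³) → 0`. [cite: Wu2026, (3.85) proof p.26 l.68–84] -/
theorem tendsto_lintegral_six_terms {K : Set E3} (hKfin : volume K ≠ ∞)
    {d e : ℕ → E3 → ℝ≥0∞} {V P : E3 → ℝ≥0∞}
    (hd : ∀ j, AEMeasurable (d j) (volume.restrict K)) (he : ∀ j, AEMeasurable (e j) (volume.restrict K))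
    (hV : AEMeasurable V (volume.restrict K)) (hP : AEMeasurable P (volume.restrict K))
    {q0 : ℝ} (hq3 : 3 < q0)
    (hVq : ∫⁻ y in K, V y ^ q0 ≠ ∞) (hPq : ∫⁻ y in K, P y ^ (q0 / 2) ≠ ∞)
    (hdlim : Tendsto (fun j => ∫⁻ y in K, d j y ^ q0) atTop (𝓝 0))
    (helim : Tendsto (fun j => ∫⁻ y in K, e j y ^ (q0 / 2)) atTop (𝓝 0)) :
    Tendsto (fun j => ∫⁻ y in K, (e j y * d j y + e j y * V y + P y * d j y +
      (3 * V y ^ 2 * d j y + 3 * V y * d j y ^ 2 + d j y ^ 3))) atTop (𝓝 0) := by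
  have hq0 : 0 < q0 := by linarith
  -- the conjugate pair `(q₀/2, q₀/(q₀−2))` written as `(s⁻¹, t⁻¹)`, `s + t = 1`
  set s : ℝ := 2 / q0 with hs_def
  set t : ℝ := 1 - 2 / q0 with ht_def
  have hs : 0 < s := by positivity
  have ht : 0 < t := by rw [ht_def, sub_pos, div_lt_one hq0]; linarith
  have hst : s + t = 1 := by rw [hs_def, ht_def]; ring
  have hsinv : s⁻¹ = q0 / 2 := by rw [hs_def, inv_div]
  have htinv_lt : t⁻¹ < q0 := by
    have ht' : t = (q0 - 2) / q0 := by rw [ht_def]; field_simp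
    rw [ht', inv_div, div_lt_iff₀ (by linarith : (0 : ℝ) < q0 - 2)]
    nlinarith
  have htinv_pos : 0 < t⁻¹ := inv_pos.2 ht
  -- reduced exponents of `d_j`: `t⁻¹` and `3`
  have hred : ∀ {r : ℝ}, 0 < r → r < q0 →
      Tendsto (fun j => ∫⁻ y in K, d j y ^ r) atTop (𝓝 0) := by
    intro r hr hrq
    refine tendsto_zero_of_le (tendsto_rpow_mul_const_zero hdlim (div_pos hr hq0)
      (ENNReal.rpow_ne_top_of_nonneg (by rw [sub_nonneg, div_le_one hq0]; exact hrq.le) hKfin))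
      fun j => setLIntegral_rpow_le_of_lt (hd j) hr hrq
  have hD3 := hred (by norm_num : (0 : ℝ) < 3) hq3
  have hDt := hred htinv_pos htinv_lt
  -- finite constants `∫ V^{t⁻¹}`, `∫ V^3`
  have hfinK : ∀ {r : ℝ}, 0 < r → r < q0 → ∫⁻ y in K, V y ^ r ≠ ∞ := by
    intro r hr hrq
    refine ne_top_of_le_ne_top ?_ (setLIntegral_rpow_le_of_lt hV hr hrq)
    exact ENNReal.mul_ne_top (ENNReal.rpow_ne_top_of_nonneg (div_pos hr hq0).le hVq)
      (ENNReal.rpow_ne_top_of_nonneg (by rw [sub_nonneg, div_le_one hq0]; exact hrq.le) hKfin)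
  have hV3 := hfinK (by norm_num : (0 : ℝ) < 3) hq3
  have hVt := hfinK htinv_pos htinv_lt
  -- the six Hölder bounds, for each `j`
  have hbound : ∀ j, ∫⁻ y in K, (e j y * d j y + e j y * V y + P y * d j y +
      (3 * V y ^ 2 * d j y + 3 * V y * d j y ^ 2 + d j y ^ 3)) ≤
      (∫⁻ y in K, e j y ^ (q0 / 2)) ^ s * (∫⁻ y in K, d j y ^ t⁻¹) ^ t +
      (∫⁻ y in K, e j y ^ (q0 / 2)) ^ s * (∫⁻ y in K, V y ^ t⁻¹) ^ t +
      (∫⁻ y in K, P y ^ (q0 / 2)) ^ s * (∫⁻ y in K, d j y ^ t⁻¹) ^ t +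
      (3 * ((∫⁻ y in K, V y ^ (3 : ℝ)) ^ ((2 : ℝ) / 3) * (∫⁻ y in K, d j y ^ (3 : ℝ)) ^ ((1 : ℝ) / 3)) +
        3 * ((∫⁻ y in K, V y ^ (3 : ℝ)) ^ ((1 : ℝ) / 3) * (∫⁻ y in K, d j y ^ (3 : ℝ)) ^ ((2 : ℝ) / 3)) +
        ∫⁻ y in K, d j y ^ (3 : ℝ)) := by
    intro j
    have h1 := setLIntegral_mul_le_holder (he j) (hd j) hs ht hst
    have h2 := setLIntegral_mul_le_holder (he j) hV hs ht hst
    have h3 := setLIntegral_mul_le_holder hP (hd j) hs ht hst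
    have h4 := setLIntegral_mul_le_holder ((hV.pow_const (2 : ℝ))) (hd j)
      (by norm_num : (0 : ℝ) < 2 / 3) (by norm_num : (0 : ℝ) < 1 / 3) (by norm_num)
    have h5 := setLIntegral_mul_le_holder hV ((hd j).pow_const (2 : ℝ))
      (by norm_num : (0 : ℝ) < 1 / 3) (by norm_num : (0 : ℝ) < 2 / 3) (by norm_num)
    rw [hsinv] at h1 h2 h3
    have e23 : ((2 : ℝ) / 3)⁻¹ = 3 / 2 := by norm_num
    have e13 : ((1 : ℝ) / 3)⁻¹ = 3 := by norm_num
    have epow : ∀ x : ℝ≥0∞, (x ^ (2 : ℝ)) ^ ((3 : ℝ) / 2) = x ^ (3 : ℝ) := fun x => by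
      rw [← ENNReal.rpow_mul]; norm_num
    rw [e23, e13] at h4 h5
    simp_rw [epow] at h4 h5
    -- split the integral of the sum
    have hdj := hd j
    have hej := he j
    have hm1 : AEMeasurable (fun y => e j y * d j y) (volume.restrict K) := by fun_prop
    have hm12 : AEMeasurable (fun y => e j y * d j y + e j y * V y) (volume.restrict K) := by
      fun_prop
    have hm123 : AEMeasurable (fun y => e j y * d j y + e j y * V y + P y * d j y)
        (volume.restrict K) := by fun_prop
    have hm4 : AEMeasurable (fun y => 3 * V y ^ 2 * d j y) (volume.restrict K) := by fun_prop
    have hm45 : AEMeasurable (fun y => 3 * V y ^ 2 * d j y + 3 * V y * d j y ^ 2)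
        (volume.restrict K) := by fun_prop
    have hm4' : AEMeasurable (fun y => V y ^ (2 : ℝ) * d j y) (volume.restrict K) := by fun_prop
    have hm5' : AEMeasurable (fun y => V y * d j y ^ (2 : ℝ)) (volume.restrict K) := by fun_prop
    rw [lintegral_add_left' hm123, lintegral_add_left' hm12, lintegral_add_left' hm1,
      lintegral_add_left' hm45, lintegral_add_left' hm4]
    have pow_two_eq_rpow : ∀ x : ℝ≥0∞, x ^ 2 = x ^ (2 : ℝ) := fun x => by
      rw [← ENNReal.rpow_natCast]; norm_num
    have pow_three_eq_rpow : ∀ x : ℝ≥0∞, x ^ 3 = x ^ (3 : ℝ) := fun x => by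
      rw [← ENNReal.rpow_natCast]; norm_num
    simp_rw [pow_two_eq_rpow, pow_three_eq_rpow]
    -- (`gcongr` closes the first three summands by `h1`, `h2`, `h3` from the context)
    gcongr ?_ + ?_ + ?_ + (?_ + ?_ + _)
    · rw [show (fun y => 3 * V y ^ (2 : ℝ) * d j y) = fun y => 3 * (V y ^ (2 : ℝ) * d j y) from
        funext fun y => mul_assoc _ _ _, lintegral_const_mul'' _ hm4']
      exact mul_le_mul' le_rfl h4
    · rw [show (fun y => 3 * V y * d j y ^ (2 : ℝ)) = fun y => 3 * (V y * d j y ^ (2 : ℝ)) from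
        funext fun y => mul_assoc _ _ _, lintegral_const_mul'' _ hm5']
      exact mul_le_mul' le_rfl h5
  -- each of the six bounds tends to zero
  have hEs : Tendsto (fun j => (∫⁻ y in K, e j y ^ (q0 / 2)) ^ s) atTop (𝓝 0) := by
    have := tendsto_rpow_mul_const_zero helim hs ENNReal.one_ne_top
    simpa only [mul_one] using this
  have hDtt : Tendsto (fun j => (∫⁻ y in K, d j y ^ t⁻¹) ^ t) atTop (𝓝 0) := by
    have := tendsto_rpow_mul_const_zero hDt ht ENNReal.one_ne_top
    simpa only [mul_one] using this
  have hT1 : Tendsto (fun j => (∫⁻ y in K, e j y ^ (q0 / 2)) ^ s * (∫⁻ y in K, d j y ^ t⁻¹) ^ t)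
      atTop (𝓝 0) := by
    have := ENNReal.Tendsto.mul hEs (Or.inr ENNReal.zero_ne_top) hDtt (Or.inr ENNReal.zero_ne_top)
    simpa only [mul_zero] using this
  have hT2 : Tendsto (fun j => (∫⁻ y in K, e j y ^ (q0 / 2)) ^ s * (∫⁻ y in K, V y ^ t⁻¹) ^ t)
      atTop (𝓝 0) :=
    tendsto_rpow_mul_const_zero helim hs (ENNReal.rpow_ne_top_of_nonneg ht.le hVt)
  have hT3 : Tendsto (fun j => (∫⁻ y in K, P y ^ (q0 / 2)) ^ s * (∫⁻ y in K, d j y ^ t⁻¹) ^ t)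
      atTop (𝓝 0) := by
    have := tendsto_rpow_mul_const_zero hDt ht (ENNReal.rpow_ne_top_of_nonneg hs.le hPq)
    simpa only [mul_comm] using this
  have hT4 : Tendsto (fun j => 3 * ((∫⁻ y in K, V y ^ (3 : ℝ)) ^ ((2 : ℝ) / 3) *
      (∫⁻ y in K, d j y ^ (3 : ℝ)) ^ ((1 : ℝ) / 3))) atTop (𝓝 0) := by
    have h := tendsto_rpow_mul_const_zero hD3 (by norm_num : (0 : ℝ) < 1 / 3)
      (ENNReal.mul_ne_top (by norm_num : (3 : ℝ≥0∞) ≠ ∞)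
        (ENNReal.rpow_ne_top_of_nonneg (by norm_num : (0 : ℝ) ≤ 2 / 3) hV3))
    refine (tendsto_congr fun j => ?_).1 h
    ring
  have hT5 : Tendsto (fun j => 3 * ((∫⁻ y in K, V y ^ (3 : ℝ)) ^ ((1 : ℝ) / 3) *
      (∫⁻ y in K, d j y ^ (3 : ℝ)) ^ ((2 : ℝ) / 3))) atTop (𝓝 0) := by
    have h := tendsto_rpow_mul_const_zero hD3 (by norm_num : (0 : ℝ) < 2 / 3)
      (ENNReal.mul_ne_top (by norm_num : (3 : ℝ≥0∞) ≠ ∞)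
        (ENNReal.rpow_ne_top_of_nonneg (by norm_num : (0 : ℝ) ≤ 1 / 3) hV3))
    refine (tendsto_congr fun j => ?_).1 h
    ring
  have hsum := ((hT1.add hT2).add hT3).add ((hT4.add hT5).add hD3)
  simp only [add_zero] at hsum
  exact tendsto_zero_of_le hsum hbound

end Summit.NavierStokesRegularity.NavierStokesRegularity.Theorems.Wu2026Salvage

end

-- WHAT THIS IS NOT: not a claim about NS regularity or blow-up; not a claim about any author beyond the typed locator.
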